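import Mathlib

/-!
# Finite energy with an inside configuration chosen as a function of the outside (abstract form)

Cell pub-perc-repro0, seat p6. Kernel-checked companion of `proofs/UNIQUENESS-p6-v1.md`, Lemma 2.1
(finite energy): for a product `μ.prod ν` of a probability measure `μ` on a FINITE (discrete) type `α`
— the configurations on the finite bond set `F`, `μ = P_F` with `μ {σ} ≥ c := min(p,1−p)^{|F|}` — and a
probability measure `ν` on a measurable space `β` — the exterior configurations, `ν = P_{F^c}` — and a
measurable event `A ⊆ α × β`, the event
  `A^s := { (s b, b) : (a, b) ∈ A }`  (replace the inside part by `s` of the outside part)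
obtained from a measurable choice `s : β → α` satisfies `(μ.prod ν) A^s ≥ c · (μ.prod ν) A`.
The proof is the paper's: `A^s = ⋃_σ {σ} ×ˢ (π A ∩ s⁻¹ {σ})` with `π A = ⋃_τ { b | (τ, b) ∈ A }` the
(measurable, finite union of sections) projection, so `(μ.prod ν) A^s = Σ_σ μ {σ} ν(π A ∩ s⁻¹{σ}) ≥ c ν(π A)`,
and `A ⊆ univ ×ˢ π A` gives `(μ.prod ν) A ≤ ν (π A)`. No percolation object appears.
-/

namespace Summit.Ventures.PercRepro0.FiniteEnergy

open MeasureTheory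

/-- Finite energy, abstract form (UNIQUENESS-p6-v1, Lemma 2.1). -/
theorem prod_measure_choice_le {α β : Type*} [Fintype α] [MeasurableSpace α]
    [MeasurableSingletonClass α] [MeasurableSpace β]
    (μ : Measure α) [IsProbabilityMeasure μ] (ν : Measure β) [IsProbabilityMeasure ν]
    (c : ENNReal) (hc : ∀ σ : α, c ≤ μ {σ})
    (A : Set (α × β)) (hA : MeasurableSet A) (s : β → α) (hs : Measurable s) :
    c * (μ.prod ν) A ≤ (μ.prod ν) {x : α × β | x.1 = s x.2 ∧ ∃ a, (a, x.2) ∈ A} := by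
  classical
  -- the projection of `A` to the second factor: a finite union of sections
  set πA : Set β := {b | ∃ a, (a, b) ∈ A} with hπA
  have hπA_eq : πA = ⋃ τ : α, (fun b => (τ, b)) ⁻¹' A := by
    ext b
    simp only [hπA, Set.mem_setOf_eq, Set.mem_iUnion, Set.mem_preimage]
  have hπA_meas : MeasurableSet πA := by
    rw [hπA_eq]
    exact MeasurableSet.iUnion fun τ => hA.preimage (by fun_prop)
  -- the pieces `B σ := π A ∩ s⁻¹ {σ}`
  set B : α → Set β := fun σ => πA ∩ s ⁻¹' {σ} with hB
  have hB_meas : ∀ σ, MeasurableSet (B σ) := fun σ =>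
    hπA_meas.inter (hs (measurableSet_singleton σ))
  have hB_disj : Set.PairwiseDisjoint (Finset.univ : Finset α) B := by
    intro σ _ σ' _ hne
    refine Set.disjoint_left.mpr fun b hb hb' => hne ?_
    have h1 : s b = σ := hb.2
    have h2 : s b = σ' := hb'.2
    exact h1.symm.trans h2
  have hB_union : (⋃ σ ∈ (Finset.univ : Finset α), B σ) = πA := by
    ext b
    simp only [Set.mem_iUnion, Finset.mem_univ, exists_true_left, hB, Set.mem_inter_iff,
      Set.mem_preimage, Set.mem_singleton_iff]
    exact ⟨fun ⟨_, h, _⟩ => h, fun h => ⟨s b, h, rfl⟩⟩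
  -- the modified event as a finite disjoint union of rectangles
  have hAs_eq : {x : α × β | x.1 = s x.2 ∧ ∃ a, (a, x.2) ∈ A}
      = ⋃ σ ∈ (Finset.univ : Finset α), ({σ} : Set α) ×ˢ B σ := by
    ext ⟨a, b⟩
    simp only [Set.mem_setOf_eq, Set.mem_iUnion, Finset.mem_univ, exists_true_left,
      Set.mem_prod, Set.mem_singleton_iff, hB, Set.mem_inter_iff, Set.mem_preimage, hπA]
    constructor
    · rintro ⟨rfl, hb⟩
      exact ⟨s b, rfl, hb, rfl⟩
    · rintro ⟨σ, rfl, hb, rfl⟩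
      exact ⟨rfl, hb⟩
  have hrect_disj : Set.PairwiseDisjoint (Finset.univ : Finset α)
      fun σ => ({σ} : Set α) ×ˢ B σ := by
    intro σ _ σ' _ hne
    refine Set.disjoint_left.mpr fun x hx hx' => hne ?_
    have h1 : x.1 = σ := hx.1
    have h2 : x.1 = σ' := hx'.1
    exact h1.symm.trans h2
  have hrect_meas : ∀ σ ∈ (Finset.univ : Finset α), MeasurableSet (({σ} : Set α) ×ˢ B σ) :=
    fun σ _ => (measurableSet_singleton σ).prod (hB_meas σ)
  -- measure of the modified event
  have hAs : (μ.prod ν) {x : α × β | x.1 = s x.2 ∧ ∃ a, (a, x.2) ∈ A}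
      = ∑ σ ∈ (Finset.univ : Finset α), μ {σ} * ν (B σ) := by
    rw [hAs_eq, measure_biUnion_finset hrect_disj hrect_meas]
    exact Finset.sum_congr rfl fun σ _ => Measure.prod_prod _ _
  -- measure of the projection
  have hπ : ν πA = ∑ σ ∈ (Finset.univ : Finset α), ν (B σ) := by
    rw [← hB_union, measure_biUnion_finset hB_disj fun σ _ => hB_meas σ]
  -- the original event sits inside `univ ×ˢ π A`
  have hA_le : (μ.prod ν) A ≤ ν πA := by
    have hsub : A ⊆ (Set.univ : Set α) ×ˢ πA := fun x hx => ⟨Set.mem_univ _, ⟨x.1, hx⟩⟩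
    calc (μ.prod ν) A ≤ (μ.prod ν) ((Set.univ : Set α) ×ˢ πA) := measure_mono hsub
      _ = μ Set.univ * ν πA := Measure.prod_prod _ _
      _ = ν πA := by rw [measure_univ, one_mul]
  calc c * (μ.prod ν) A ≤ c * ν πA := by gcongr
    _ = ∑ σ ∈ (Finset.univ : Finset α), c * ν (B σ) := by rw [hπ, Finset.mul_sum]
    _ ≤ ∑ σ ∈ (Finset.univ : Finset α), μ {σ} * ν (B σ) :=
        Finset.sum_le_sum fun σ _ => by gcongr; exact hc σ
    _ = (μ.prod ν) {x : α × β | x.1 = s x.2 ∧ ∃ a, (a, x.2) ∈ A} := hAs.symm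

end Summit.Ventures.PercRepro0.FiniteEnergy
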